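import Summits.ABC.IUTFork.Repair.CandJoshi3
import Summits.ABC.IUTFork.Repair.CandJoshi3Union
import Summits.ABC.IUTFork.Repair.CandMochizuki7Envelope
import Summits.ABC.IUTFork.Repair.CandInternal8
import Summits.ABC.IUTFork.Repair.CandDupuyHilado32
import Summits.ABC.IUTFork.Cor312StatementStability
import Summits.ABC.IUTFork.Cor312StatementPilotNouns
import Summits.ABC.IUTFork.Cor312PinnedHonestInflation
import Summits.ABC.IUTFork.Cor312OrbitExcursionWitness
import Summits.ABC.IUTFork.Cor312PilotKummerNaturalThm311
import Summits.ABC.IUTFork.Cor312HullGainRamifiedGlobal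
import HarnessLib

/-!
# IUT REPAIR branch (rung LADDER-ABC:A2.RP), class (iii) JOSHI, row RP-J02a — `CandJoshi3Boundary`:
# THE q-ENVELOPE BOUNDARY LAW — in the (Ind1)/(Ind2) regime CONFINED to the q-pilot region the typed Corollary 3.12 holds
# AT MOST at equality, and the covering door H_J3 (`CandJoshi3.LocusCovers`) inhabits exactly that boundary

PROOF-ONLY record file (D-0012; no definition, no `Prop` fact, no instance) of the abc-iut cell, IUT REPAIR branch (human ruling
D-0077(2); director-abc 2026-08-26T05:11:35Z; REPAIR-SPEC v0.6d), seat abc-iut-rp-j1 (gen 5), sequel of `CandJoshi3` (p428372, the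
candidate H_J3 `LocusCovers` = «the theta-values locus — the UNION of the possible images of the Θ-pilot — covers the q-pilot region»,
ATS II arXiv:2111.04890v2 §9 p. 15 / Thm. 9.1.1 p. 13 / Thm. 10.1.1 p. 16, typed STRONGER-THAN-PRINT in form, T-d of record) and of the two
HONEST union-cover beds on which H_J3 holds with the typed Statement TRUE AT EQUALITY and the residual S FALSE: abc-iut-rp-j3's COV
(`Cor312OrbitCoveringWitness`, cell of record) and this lineage's P♮∪ (`Cor312UnionCoverThm311` + `Repair/CandJoshi3Union`, p454247).
TAKES NO SIDE on [IUTchIII] Cor. 3.12 or on any author (Mochizuki / Scholze–Stix / Joshi / Dupuy–Hilado); every hypothesis is an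
INLINE binder; nothing is asserted; typed ≠ proved; model data ≠ intended objects. DEFS-FREEZE respected (frozen files imported).

## THE QUESTION this file answers (bed-free)
Both union-cover beds land EXACTLY on `−|log(Θ)| = −|log(q)|`. Is that an accident of the two constructions, or a law? And where, in the
zoo of beds, can the typed Corollary hold with SLACK? The answer is a law of the frozen interface, with no volume honesty, no pin on the
Θ-side and (for the covering door) no volume axiom at all.

## q-CONFINEMENT (the hypothesis class; inline, never a `def`)
At a packet `(j, v_ℚ)` call the Θ-data **q-confined** when EVERY possible image of the Θ-pilot (every `⟨(Ind1)∪(Ind2)⟩`-translate of the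
(Ind3)-enlarged Kummer region `thetaRegion3`) lies inside the q-pilot region `qRegion` — abc-iut-rp-d2's binder `hnest` of
`CandInternal8.thetaHull_subset_qRegion`. It FOLLOWS (`confined_of_nested_of_qStable`, via abc-iut-c312-7's closure lemma
`Cor312.Setting.possibleImage_subset`, `Cor312StatementStability`) from honest NESTING `thetaRegion3 ⊆ qRegion` (print: `q^{j²}·𝒪 ⊆ q·𝒪`,
the (Ind3)-images inside the q-image) together with STABILITY of the q-pilot region under the (Ind1)/(Ind2) GENERATORS (every isometry of
the log-shell fixes the lattice ball `q·𝒪`, [IUTchII] Ex. 1.8 (iv); Dupuy–Hilado's `Aut(𝓘)` fixes every `p^k·𝓘`). It is the BOUNDARY CASE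
`B := qRegion` of abc-iut-rp-m1's (Ind1)/(Ind2)-STABLE ENVELOPE (`CandMochizuki7.negLogTheta_le_of_stable_envelope`, RP-M47 ∀-form): the one
envelope whose averaged volume IS `−|log(q)|`, where that barrier's strict hypothesis `hlt` just fails. It holds at the pinned countermodel
(`CandInternal8.nested_pinnedSetting`), on COV / P♮∪ (§4), on U / COSET / LS / every ball-frame bed whose Ism lies in the stabiliser of `q·𝒪`;
it sits strictly ABOVE abc-iut-rp-h3's `CandDupuyHilado32.OrbitInside` (orbit inside the Θ-data themselves ⟹ hull = Θ-polydisc ⟹ ¬Statement).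

## RESULTS (kernel; `PN` = procession normalisation, Prop. 3.9 (i))
§1 set level (any setting): `confined_of_nested_of_qStable`; `confined_of_orbitInside` (rp-h3's class is the rung below);
   `thetaHull_subset_qRegion_of_confined` (packet-local form of rp-d2's lemma);
   **`licence_iff_thetaHull_eq_of_confined`**: under confinement abc-iut-c312-1's hull LICENCE «q-region ⊆ ⁿ˒°𝒰» is EQUIVALENT to
   «ⁿ˒°𝒰_{j,v_ℚ} = qRegion in every packet of 𝔽_l^⋇» (the hull can at most FILL the q-region).
§2 volume level (monotone log-volume `Cor312Vol.LogvolMono`, [IUTchIII] Prop. 3.9 (i)): `hullVol_le_qLocal_of_confined`;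
   **`negLogTheta_le_negLogQ_of_confined`** («NO SLACK»: `−|log(Θ)| ≤ −|log(q)|`; = rp-m1's envelope barrier at `B = qRegion`,
   `negLogTheta_le_negLogQ_of_qStable` consumes it BY NAME); **`statement_iff_equality_of_confined`**: typed Cor. 3.12 ⟺ `−|log(Θ)| = −|log(q)|`;
   **`statement_iff_hullVol_eq_of_confined`**: ⟺ every packet of `𝔽_l^⋇` has hull-volume = q-volume (abc-iut-c312-5's strict finsum/PN
   bookkeeping `Thm311.Real.finsum_lt_finsum_of_le_of_lt` BY NAME); **`statement_iff_licence_of_confined`**: with volume-injective nested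
   hull-sets (equal volume inside `qRegion` ⟹ equal set: balls, lattices) Statement ⟺ Licence ⟺ hull = q-region packetwise — in the confined
   regime the hull-level residual (GapH3's licence) is NECESSARY as well as sufficient; **`exists_escape_of_strict`**: the Statement WITH
   SLACK forces, at some packet of `𝔽_l^⋇`, a possible image NOT inside the q-pilot region.
§3 THE COVERING DOOR AT THE BOUNDARY, VOLUME-AXIOM-FREE: `QPinned ∧ LocusCovers ∧ confinement` ⟹ `⋃ possibleImages = qRegion = ⁿ˒°𝒰`
   (`sUnion_possibleImages_eq_qRegion_of_locusCovers`, `thetaHull_eq_qRegion_of_locusCovers`) ⟹ `thetaLocal = qLocal`, `ThetaFinite`, and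
   **`boundary_of_locusCovers : Statement ∧ −|log(Θ)| = −|log(q)|`** — no `LogvolMono`, no `LogvolInvariant`, no Θ-pin, no honesty: pure
   set algebra plus «the q-region admits a hull» (`HasHull`, true in every frame of record). This is the bed-free reason COV and P♮∪ sit
   at equality; conversely (§2) a confined H_J3-bed can sit nowhere else.
§4 cells BY NAME: P♮∪ confined (`union_confined`) and its equality RE-DERIVED through §3 (`union_boundary_by_law`, concordant with
   `UnionWitness.uSetting_statement` and rp-s1's `ObstructionSS45.union_boundary_via_law`); CM confined with `¬Statement` (the boundary not
   reached: `pinned_confined_not_statement`); **P♮ₑ (`ExcursionWitness.excSetting`, −1/2 < −3/8) and P♮ (`NaturalWitness.natSetting`, −2 < −1)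
   are NOT q-confined** (`exc_not_confined`, `nat_not_confined`) — derived from their STRICT inequalities alone: some permuted deep box /
   some half-coset translate leaves the q-polydisc (for P♮ₑ this sharpens `excSetting_excursion`, which exits the Θ-box).
READING (neutral, for §J): in the (Ind1)/(Ind2) regime confined to the q-pilot region the typed Corollary holds at most AT EQUALITY, and at
equality iff the multiradial hull FILLS the q-region in every packet — the union-cover beds are that boundary and H_J3 is a volume-free
ticket to it; SLACK requires a possible image OUTSIDE `q·𝒪`: (Ind3)-containers beyond the q-image (K/KS/TIGHT: hypothesis (N) fails),
anisotropic excursion (P♮ₑ, P♮: stability of `q·𝒪` fails), or Θ-regions not nested in `q·𝒪` (the log-shell family LS, FAT). Which reading of Ism / (Ind3) describes the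
genuine IUT data is the dispute, untouched. [claim: Mochizuki2012, status: disputed] [claim: Joshi2021ATSII, status: disputed]
[cite: ScholzeStix2018, §2.2 pp. 9–10] [cite: DupuyHilado2020, §6.2 pp. 19–20]
-/

noncomputable section

open Set

namespace Summit.ABC.IUTFork.Repair.CandJoshi3Boundary

open Thm311 Cor312 Cor312Vol Literature.IUT.LogThetaLattice Summit.ABC.IUTFork.Repair.CandJoshi3

section Law

variable {T : ThetaIndex} (S : LatticeSituation T) (P : Cor312.Setting S.toSituation)
  (ρ : (∀ v : T.V, v ∈ T.Vbad → Set (S.L.StarPacket v)) → ∀ (j : T.Label) (vQ : T.VQ), Set (S.L.Packet j vQ))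
  (qK : ∀ v : T.V, v ∈ T.Vbad → Set (S.L.StarPacket v))

/-! ## 1. Set level: confinement, the hull inside the q-region, the licence as hull = q-region -/

/-- **q-confinement from honest nesting + generator-stability of the q-region** (abc-iut-c312-7's closure lemma
`Cor312.Setting.possibleImage_subset` with `W := qRegion`): if the (Ind3)-enlarged Θ-region lies in the q-pilot region and every (Ind1)- or (Ind2)-family
maps the q-pilot region onto itself, then EVERY possible image of the Θ-pilot lies in the q-pilot region. [folklore] -/
theorem confined_of_nested_of_qStable {j : T.Label} {vQ : T.VQ} (hN : P.thetaRegion3 j vQ ⊆ P.qRegion j vQ)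
    (hQ : ∀ Φ ∈ S.L.Ind1Family ∪ S.L.Ind2Family, Φ j vQ '' P.qRegion j vQ = P.qRegion j vQ) :
    ∀ U ∈ P.possibleImages j vQ, U ⊆ P.qRegion j vQ :=
  fun _ hU => P.possibleImage_subset hQ hN hU

/-- Under q-confinement at a packet the holomorphic hull `ⁿ˒°𝒰_{j,v_ℚ}` lies in the q-pilot region (the q-region is a hull-set, `Setting.qRegion_mem`,
and the hull is the smallest hull-set containing the union; packet-local form of abc-iut-rp-d2's `CandInternal8.thetaHull_subset_qRegion`).
[folklore] -/
theorem thetaHull_subset_qRegion_of_confined {j : T.Label} {vQ : T.VQ} (h : ∀ U ∈ P.possibleImages j vQ, U ⊆ P.qRegion j vQ) :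
    P.thetaHull j vQ ⊆ P.qRegion j vQ :=
  (P.frame j vQ).hull_subset_of_mem (P.qRegion_mem j vQ) (Set.sUnion_subset h)

/-- Under q-confinement the union of the possible images is relatively compact (it lies in the hull-set `qRegion`). [folklore] -/
theorem isBounded_sUnion_of_confined {j : T.Label} {vQ : T.VQ} (h : ∀ U ∈ P.possibleImages j vQ, U ⊆ P.qRegion j vQ) :
    (P.frame j vQ).IsBounded (⋃₀ P.possibleImages j vQ) :=
  (P.frame j vQ).bounded_mono _ _ (Set.sUnion_subset h) ((P.frame j vQ).hul_bounded _ (P.qRegion_mem j vQ))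

/-- **LICENCE ⟺ HULL = q-REGION under confinement.** abc-iut-c312-1's hull-level licence «the q-pilot region lies in `ⁿ˒°𝒰_{j,v_ℚ}` at every label
of `𝔽_l^⋇`» (`Thm311ToCor312.Licence`, the content of GapH3) is, on q-confined data, the statement that the hull FILLS the q-region exactly —
it can do no more. No volume is used. [claim: Mochizuki2012, status: disputed] -/
theorem licence_iff_thetaHull_eq_of_confined
    (h : ∀ (i : Fin T.lstar) (vQ : T.VQ), ∀ U ∈ P.possibleImages (Setting.labelSucc i) vQ, U ⊆ P.qRegion (Setting.labelSucc i) vQ) :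
    Thm311ToCor312.Licence P ↔
      ∀ (i : Fin T.lstar) (vQ : T.VQ), P.thetaHull (Setting.labelSucc i) vQ = P.qRegion (Setting.labelSucc i) vQ :=
  ⟨fun hL i vQ => Set.Subset.antisymm (thetaHull_subset_qRegion_of_confined S P (h i vQ)) (hL i vQ),
    fun hE i vQ => (hE i vQ).symm.subset⟩

/-- **abc-iut-rp-h3's barrier class lies INSIDE the confined regime**: `CandDupuyHilado32.OrbitInside` (every `⟨(Ind1)∪(Ind2)⟩`-translate of
the (Ind3)-region inside the Θ-pilot's `m = 0` Kummer image) + that image NESTED in the q-pilot region ⟹ q-confined on `𝔽_l^⋇`. Inside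
`OrbitInside` the hull is the Θ-polydisc and the typed Corollary FAILS on honest volumes (`CandDupuyHilado32.orbit_barrier_statement`);
q-confinement is the next rung up — the Corollary CAN hold there, but only at equality (§2), as on P♮∪, which is confined and NOT
`OrbitInside` (`CandJoshi3Union.union_not_orbitInside`). [folklore] -/
theorem confined_of_orbitInside (ho : CandDupuyHilado32.OrbitInside S P)
    (hN : ∀ (i : Fin T.lstar) (vQ : T.VQ), P.thetaRegion 0 (Setting.labelSucc i) vQ ⊆ P.qRegion (Setting.labelSucc i) vQ)
    (i : Fin T.lstar) (vQ : T.VQ) :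
    ∀ U ∈ P.possibleImages (Setting.labelSucc i) vQ, U ⊆ P.qRegion (Setting.labelSucc i) vQ := by
  rintro U ⟨Φ, hΦ, rfl⟩
  exact (ho Φ hΦ i vQ).trans (hN i vQ)

/-! ## 2. Volume level: no slack, and the equality characterisations -/

/-- Packet form: under q-confinement, monotone log-volume and `HullDefined` (the hull is an admissible region), the hull-volume is at most the
q-volume. [claim: Mochizuki2012, status: disputed] -/
theorem hullVol_le_qLocal_of_confined (hmono : LogvolMono P) (i : Fin T.lstar) (vQ : T.VQ)
    (hdef : P.HullDefined (Setting.labelSucc i) vQ)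
    (h : ∀ U ∈ P.possibleImages (Setting.labelSucc i) vQ, U ⊆ P.qRegion (Setting.labelSucc i) vQ) :
    (S.D P.n).logvol _ vQ (P.thetaHull (Setting.labelSucc i) vQ) ≤ P.qLocal (Setting.labelSucc i) vQ :=
  hmono i vQ (P.thetaHull_adm hdef) (P.hul_adm _ vQ _ (P.qRegion_mem _ vQ)) (thetaHull_subset_qRegion_of_confined S P h)

/-- **NO SLACK.** Under q-confinement at the labels of `𝔽_l^⋇`, monotone log-volume and `ThetaFinite`: `−|log(Θ)| ≤ −|log(q)|` — whatever the pins,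
the honesty of the volumes or the size of the indeterminacy group. [claim: Mochizuki2012, status: disputed] -/
theorem negLogTheta_le_negLogQ_of_confined (hmono : LogvolMono P) (hfin : P.ThetaFinite)
    (h : ∀ (i : Fin T.lstar) (vQ : T.VQ), ∀ U ∈ P.possibleImages (Setting.labelSucc i) vQ, U ⊆ P.qRegion (Setting.labelSucc i) vQ) :
    P.negLogTheta ≤ ((P.negLogQ : ℝ) : WithTop ℝ) := by
  rw [PinnedHonest.negLogTheta_eq_of_thetaFinite S P hfin, WithTop.coe_le_coe]
  unfold Setting.negLogQ
  exact Cor312Vol.processionNormalized_mono fun i =>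
    finsum_le_finsum' (PinnedHonest.hullVol_support_finite S P hfin i) (P.qSupport_finite _) fun vQ =>
      hullVol_le_qLocal_of_confined S P hmono i vQ (hullDefined_of_thetaFinite hfin i vQ) (h i vQ)

/-- The same bound in abc-iut-rp-m1's currency, CONSUMED BY NAME: with the q-pilot region as the (Ind1)/(Ind2)-STABLE ENVELOPE of the Θ-data
(`B := qRegion` in `CandMochizuki7.negLogTheta_le_of_stable_envelope`; hypotheses: nesting at the labels of `𝔽_l^⋇` and stability of the q-region
under the whole indeterminacy group) the envelope barrier reads `−|log(Θ)| ≤ PN(Σᶠ qLocal) = −|log(q)|` — its BOUNDARY CASE. [claim: Mochizuki2012, status: disputed] -/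
theorem negLogTheta_le_negLogQ_of_qStable (hmono : LogvolMono P) (hfin : P.ThetaFinite)
    (hN : ∀ (i : Fin T.lstar) (vQ : T.VQ), P.thetaRegion3 (Setting.labelSucc i) vQ ⊆ P.qRegion (Setting.labelSucc i) vQ)
    (hQ : ∀ Φ ∈ Setting.indGroup S.toSituation, ∀ (i : Fin T.lstar) (vQ : T.VQ),
      Φ _ vQ '' P.qRegion (Setting.labelSucc i) vQ ⊆ P.qRegion (Setting.labelSucc i) vQ) :
    P.negLogTheta ≤ ((P.negLogQ : ℝ) : WithTop ℝ) :=
  CandMochizuki7.negLogTheta_le_of_stable_envelope S P hmono hfin (fun i vQ => P.qRegion (Setting.labelSucc i) vQ)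
    (fun _ vQ => P.qRegion_mem _ vQ) hN hQ (fun _ => P.qSupport_finite _)

/-- **STATEMENT ⟺ EQUALITY under confinement.** With monotone log-volume, on q-confined data the typed Corollary 3.12
(`−|log(Θ)| ∈ ℝ ∧ −|log(q)| ≤ −|log(Θ)|`) holds IFF `−|log(Θ)| = −|log(q)|`. [claim: Mochizuki2012, status: disputed] -/
theorem statement_iff_equality_of_confined (hmono : LogvolMono P)
    (h : ∀ (i : Fin T.lstar) (vQ : T.VQ), ∀ U ∈ P.possibleImages (Setting.labelSucc i) vQ, U ⊆ P.qRegion (Setting.labelSucc i) vQ) :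
    P.Statement ↔ P.negLogTheta = ((P.negLogQ : ℝ) : WithTop ℝ) :=
  ⟨fun hS => le_antisymm (negLogTheta_le_negLogQ_of_confined S P hmono (P.thetaFinite_of_statement hS) h) hS.2,
    fun hE => ⟨by rw [hE]; exact WithTop.coe_ne_top, hE.ge⟩⟩

/-- **STATEMENT ⟺ PACKETWISE VOLUME EQUALITY under confinement** (monotone log-volume, `ThetaFinite`): the typed Corollary holds IFF in EVERY
packet `(j, v_ℚ)`, `j ∈ 𝔽_l^⋇`, the hull-volume EQUALS the q-volume (each term is `≤`, so the averaged sums agree iff all terms do;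
abc-iut-c312-5's strict bookkeeping `Thm311.Real.finsum_lt_finsum_of_le_of_lt` / `processionNormalized_lt_of_le_of_lt`). [claim: Mochizuki2012, status: disputed] -/
theorem statement_iff_hullVol_eq_of_confined (hmono : LogvolMono P) (hfin : P.ThetaFinite)
    (h : ∀ (i : Fin T.lstar) (vQ : T.VQ), ∀ U ∈ P.possibleImages (Setting.labelSucc i) vQ, U ⊆ P.qRegion (Setting.labelSucc i) vQ) :
    P.Statement ↔ ∀ (i : Fin T.lstar) (vQ : T.VQ),
      (S.D P.n).logvol _ vQ (P.thetaHull (Setting.labelSucc i) vQ) = P.qLocal (Setting.labelSucc i) vQ := by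
  have hl : 0 < T.lstar := lt_of_lt_of_le (by norm_num) T.two_le_lstar
  have hle : ∀ (i : Fin T.lstar) (vQ : T.VQ),
      (S.D P.n).logvol _ vQ (P.thetaHull (Setting.labelSucc i) vQ) ≤ P.qLocal (Setting.labelSucc i) vQ := fun i vQ =>
    hullVol_le_qLocal_of_confined S P hmono i vQ (hullDefined_of_thetaFinite hfin i vQ) (h i vQ)
  rw [PinnedHonest.statement_iff_of_thetaFinite S P hfin]
  constructor
  · intro hS i vQ
    by_contra hne
    have hlt : ∑ᶠ vQ' : T.VQ, (S.D P.n).logvol _ vQ' (P.thetaHull (Setting.labelSucc i) vQ') <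
        ∑ᶠ vQ' : T.VQ, P.qLocal (Setting.labelSucc i) vQ' :=
      Thm311.Real.finsum_lt_finsum_of_le_of_lt (PinnedHonest.hullVol_support_finite S P hfin i) (P.qSupport_finite _)
        (hle i) (lt_of_le_of_ne (hle i vQ) hne)
    have hPN := Thm311.Real.processionNormalized_lt_of_le_of_lt hl
      (f := fun i' : Fin T.lstar => ∑ᶠ vQ' : T.VQ, (S.D P.n).logvol _ vQ' (P.thetaHull (Setting.labelSucc i') vQ'))
      (g := fun i' : Fin T.lstar => ∑ᶠ vQ' : T.VQ, P.qLocal (Setting.labelSucc i') vQ')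
      (fun i' => finsum_le_finsum' (PinnedHonest.hullVol_support_finite S P hfin i') (P.qSupport_finite _) (hle i')) hlt
    exact (not_le.mpr hPN) hS
  · intro hE
    unfold Setting.negLogQ
    refine le_of_eq (congrArg processionNormalized (funext fun i => finsum_congr fun vQ => (hE i vQ).symm))

/-- **STATEMENT ⟺ LICENCE ⟺ HULL = q-REGION under confinement**, for frames whose nested hull-sets are VOLUME-INJECTIVE inside the q-region
(inline `hinj`: a hull-set inside `qRegion` with at least the q-volume IS `qRegion` — balls `p^k·𝒪`, lattices of given index): with monotone
log-volume and `ThetaFinite`, the typed Corollary holds IFF the holomorphic hull fills the q-pilot region in every packet of `𝔽_l^⋇`, IFF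
abc-iut-c312-1's `Licence`. In the confined regime the hull-level residual is NECESSARY, not only sufficient. [claim: Mochizuki2012, status: disputed] -/
theorem statement_iff_licence_of_confined (hmono : LogvolMono P) (hfin : P.ThetaFinite)
    (h : ∀ (i : Fin T.lstar) (vQ : T.VQ), ∀ U ∈ P.possibleImages (Setting.labelSucc i) vQ, U ⊆ P.qRegion (Setting.labelSucc i) vQ)
    (hinj : ∀ (i : Fin T.lstar) (vQ : T.VQ), ∀ H ∈ (P.frame (Setting.labelSucc i) vQ).Hul,
      H ⊆ P.qRegion (Setting.labelSucc i) vQ → P.qLocal (Setting.labelSucc i) vQ ≤ (S.D P.n).logvol _ vQ H →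
        P.qRegion (Setting.labelSucc i) vQ ⊆ H) :
    (P.Statement ↔ Thm311ToCor312.Licence P) ∧
      (P.Statement ↔ ∀ (i : Fin T.lstar) (vQ : T.VQ), P.thetaHull (Setting.labelSucc i) vQ = P.qRegion (Setting.labelSucc i) vQ) := by
  have key : P.Statement ↔
      ∀ (i : Fin T.lstar) (vQ : T.VQ), P.thetaHull (Setting.labelSucc i) vQ = P.qRegion (Setting.labelSucc i) vQ := by
    rw [statement_iff_hullVol_eq_of_confined S P hmono hfin h]
    refine ⟨fun hE i vQ => Set.Subset.antisymm (thetaHull_subset_qRegion_of_confined S P (h i vQ)) ?_, fun hE i vQ => by rw [hE i vQ]; rfl⟩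
    have hd := hullDefined_of_thetaFinite hfin i vQ
    exact hinj i vQ _ ((P.frame _ vQ).hull_mem_of_hasHull hd.1 hd.2) (thetaHull_subset_qRegion_of_confined S P (h i vQ))
      (hE i vQ).ge
  exact ⟨key.trans (licence_iff_thetaHull_eq_of_confined S P h).symm, key⟩

/-- **SLACK FORCES ESCAPE.** If the typed Corollary holds STRICTLY (`−|log(q)| < −|log(Θ)|`) under monotone log-volume, then at some packet of
`𝔽_l^⋇` some possible image of the Θ-pilot is NOT inside the q-pilot region — through (Ind3)-containers beyond the q-image, a q-region moved
by the indeterminacies, or Θ-regions not nested in it. [claim: Mochizuki2012, status: disputed] -/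
theorem exists_escape_of_strict (hmono : LogvolMono P) (hS : P.Statement)
    (hlt : ((P.negLogQ : ℝ) : WithTop ℝ) < P.negLogTheta) :
    ∃ (i : Fin T.lstar) (vQ : T.VQ), ∃ U ∈ P.possibleImages (Setting.labelSucc i) vQ, ¬ U ⊆ P.qRegion (Setting.labelSucc i) vQ := by
  by_contra hall
  push Not at hall
  exact (not_le.mpr hlt) (negLogTheta_le_negLogQ_of_confined S P hmono (P.thetaFinite_of_statement hS) hall)

/-- Escape, nesting form: with STRICT Statement and honestly NESTED Θ-data (`thetaRegion3 ⊆ qRegion` on `𝔽_l^⋇`), some (Ind1)- or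
(Ind2)-GENERATOR moves the q-pilot region (`Φ '' qRegion ≠ qRegion`) at some packet. [claim: Mochizuki2012, status: disputed] -/
theorem exists_qMover_of_strict_of_nested (hmono : LogvolMono P) (hS : P.Statement)
    (hlt : ((P.negLogQ : ℝ) : WithTop ℝ) < P.negLogTheta)
    (hN : ∀ (i : Fin T.lstar) (vQ : T.VQ), P.thetaRegion3 (Setting.labelSucc i) vQ ⊆ P.qRegion (Setting.labelSucc i) vQ) :
    ∃ (i : Fin T.lstar) (vQ : T.VQ), ∃ Φ ∈ S.L.Ind1Family ∪ S.L.Ind2Family,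
      Φ (Setting.labelSucc i) vQ '' P.qRegion (Setting.labelSucc i) vQ ≠ P.qRegion (Setting.labelSucc i) vQ := by
  by_contra hall
  push Not at hall
  obtain ⟨i, vQ, U, hU, hUq⟩ := exists_escape_of_strict S P hmono hS hlt
  exact hUq (confined_of_nested_of_qStable S P (hN i vQ) (hall i vQ) U hU)

/-! ## 3. The covering door H_J3 at the boundary — no volume axiom -/

/-- Under the q-pin, H_J3 and confinement at a packet: **the union of the possible images IS the q-pilot region** (READING R3 at the union
level, the shape of `UnionWitness.qRegion_eq_sUnion_possibleImages`, bed-free). [claim: Joshi2021ATSII, status: disputed] -/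
theorem sUnion_possibleImages_eq_qRegion_of_locusCovers (hq : QPinned S P ρ qK) (hJ : LocusCovers S P ρ qK) {j : T.Label} {vQ : T.VQ}
    (h : ∀ U ∈ P.possibleImages j vQ, U ⊆ P.qRegion j vQ) : ⋃₀ P.possibleImages j vQ = P.qRegion j vQ :=
  Set.Subset.antisymm (Set.sUnion_subset h) (by rw [hq j vQ]; exact hJ j vQ)

/-- … hence **the holomorphic hull IS the q-pilot region** (a hull-set is its own hull). [claim: Joshi2021ATSII, status: disputed] -/
theorem thetaHull_eq_qRegion_of_locusCovers (hq : QPinned S P ρ qK) (hJ : LocusCovers S P ρ qK) {j : T.Label} {vQ : T.VQ}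
    (h : ∀ U ∈ P.possibleImages j vQ, U ⊆ P.qRegion j vQ) : P.thetaHull j vQ = P.qRegion j vQ := by
  refine Set.Subset.antisymm (thetaHull_subset_qRegion_of_confined S P h) ?_
  unfold Setting.thetaHull
  rw [sUnion_possibleImages_eq_qRegion_of_locusCovers S P ρ qK hq hJ h]
  exact (P.frame j vQ).subset_hull _

/-- … and the union ADMITS its hull as soon as the q-region does (`HullFrame.HasHull`; in every frame of record trivially). [folklore] -/
theorem hullDefined_of_locusCovers (hq : QPinned S P ρ qK) (hJ : LocusCovers S P ρ qK) {j : T.Label} {vQ : T.VQ}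
    (h : ∀ U ∈ P.possibleImages j vQ, U ⊆ P.qRegion j vQ) (hhas : (P.frame j vQ).HasHull (P.qRegion j vQ)) : P.HullDefined j vQ := by
  unfold Setting.HullDefined
  rw [sUnion_possibleImages_eq_qRegion_of_locusCovers S P ρ qK hq hJ h]
  exact ⟨(P.frame j vQ).hul_bounded _ (P.qRegion_mem j vQ), hhas⟩

/-- **The local Θ-term IS the local q-term** under the q-pin, H_J3, confinement and `HasHull (qRegion)` — no volume axiom. [claim: Joshi2021ATSII, status: disputed] -/
theorem thetaLocal_eq_qLocal_of_locusCovers (hq : QPinned S P ρ qK) (hJ : LocusCovers S P ρ qK) {j : T.Label} {vQ : T.VQ}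
    (h : ∀ U ∈ P.possibleImages j vQ, U ⊆ P.qRegion j vQ) (hhas : (P.frame j vQ).HasHull (P.qRegion j vQ)) :
    P.thetaLocal j vQ = ((P.qLocal j vQ : ℝ) : WithTop ℝ) := by
  unfold Setting.thetaLocal
  rw [if_pos (hullDefined_of_locusCovers S P ρ qK hq hJ h hhas), thetaHull_eq_qRegion_of_locusCovers S P ρ qK hq hJ h]
  rfl

/-- **`ThetaFinite` («−|log(Θ)| is finite») from H_J3** under the q-pin, confinement on `𝔽_l^⋇` and `HasHull (qRegion)`: the Θ-terms are the q-terms,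
finitely supported by Prop. 3.9 (iii) for the q-pilot (`Setting.qSupport_finite`). [claim: Joshi2021ATSII, status: disputed] -/
theorem thetaFinite_of_locusCovers (hq : QPinned S P ρ qK) (hJ : LocusCovers S P ρ qK)
    (h : ∀ (i : Fin T.lstar) (vQ : T.VQ), ∀ U ∈ P.possibleImages (Setting.labelSucc i) vQ, U ⊆ P.qRegion (Setting.labelSucc i) vQ)
    (hhas : ∀ (i : Fin T.lstar) (vQ : T.VQ), (P.frame (Setting.labelSucc i) vQ).HasHull (P.qRegion (Setting.labelSucc i) vQ)) :
    P.ThetaFinite := by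
  have hloc : ∀ (i : Fin T.lstar) (vQ : T.VQ),
      P.thetaLocal (Setting.labelSucc i) vQ = ((P.qLocal (Setting.labelSucc i) vQ : ℝ) : WithTop ℝ) := fun i vQ =>
    thetaLocal_eq_qLocal_of_locusCovers S P ρ qK hq hJ (h i vQ) (hhas i vQ)
  refine ⟨fun i vQ => by rw [hloc i vQ]; exact WithTop.coe_ne_top, fun i => ?_⟩
  have hfun : (fun vQ : T.VQ => (P.thetaLocal (Setting.labelSucc i) vQ).untopD 0) =
      fun vQ : T.VQ => P.qLocal (Setting.labelSucc i) vQ := by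
    funext vQ
    rw [hloc i vQ, WithTop.untopD_coe]
  rw [hfun]
  exact P.qSupport_finite _

/-- **THE COVERING DOOR LANDS EXACTLY ON THE BOUNDARY.** q-pin + H_J3 (`CandJoshi3.LocusCovers`) + q-confinement on `𝔽_l^⋇` + «the q-region
admits a hull» ⟹ the typed Corollary 3.12 HOLDS and `−|log(Θ)| = −|log(q)|` — with NO log-volume axiom (no monotonicity, no (Ind)-invariance),
no Θ-pin, no honesty hypothesis: the bed-free reason abc-iut-rp-j3's COV and this lineage's P♮∪ sit at equality. (By §2, under monotone
log-volume a confined bed can hold the Corollary nowhere else.) [claim: Joshi2021ATSII, status: disputed] -/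
theorem boundary_of_locusCovers (hq : QPinned S P ρ qK) (hJ : LocusCovers S P ρ qK)
    (h : ∀ (i : Fin T.lstar) (vQ : T.VQ), ∀ U ∈ P.possibleImages (Setting.labelSucc i) vQ, U ⊆ P.qRegion (Setting.labelSucc i) vQ)
    (hhas : ∀ (i : Fin T.lstar) (vQ : T.VQ), (P.frame (Setting.labelSucc i) vQ).HasHull (P.qRegion (Setting.labelSucc i) vQ)) :
    P.Statement ∧ P.negLogTheta = ((P.negLogQ : ℝ) : WithTop ℝ) := by
  have hfin := thetaFinite_of_locusCovers S P ρ qK hq hJ h hhas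
  have hE : P.negLogTheta = ((P.negLogQ : ℝ) : WithTop ℝ) := by
    unfold Setting.negLogTheta Setting.negLogQ
    rw [if_pos hfin]
    congr 1
    refine congrArg processionNormalized (funext fun i => finsum_congr fun vQ => ?_)
    rw [thetaLocal_eq_qLocal_of_locusCovers S P ρ qK hq hJ (h i vQ) (hhas i vQ), WithTop.untopD_coe]
  exact ⟨⟨by rw [hE]; exact WithTop.coe_ne_top, hE.ge⟩, hE⟩

/-- The same over the typed Theorem 3.11 with the three pins carried (director's shape): typed Thm. 3.11 + three pins + H_J3 + confinement
+ `HasHull` ⟹ Statement AT EQUALITY. [claim: Joshi2021ATSII, status: disputed] -/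
theorem boundary_of_thm311_of_pinned3_of_locusCovers (F : FullSituation T) (P : Cor312.Setting F.toLatticeSituation.toSituation)
    (ρ : (∀ v : T.V, v ∈ T.Vbad → Set (F.L.StarPacket v)) → ∀ (j : T.Label) (vQ : T.VQ), Set (F.L.Packet j vQ))
    (qK : ∀ v : T.V, v ∈ T.Vbad → Set (F.L.StarPacket v)) (_hThm : F.Statement)
    (hpin : PinnedRegions3 F.toLatticeSituation P ρ qK) (hJ : LocusCovers F.toLatticeSituation P ρ qK)
    (h : ∀ (i : Fin T.lstar) (vQ : T.VQ), ∀ U ∈ P.possibleImages (Setting.labelSucc i) vQ, U ⊆ P.qRegion (Setting.labelSucc i) vQ)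
    (hhas : ∀ (i : Fin T.lstar) (vQ : T.VQ), (P.frame (Setting.labelSucc i) vQ).HasHull (P.qRegion (Setting.labelSucc i) vQ)) :
    P.Statement ∧ P.negLogTheta = ((P.negLogQ : ℝ) : WithTop ℝ) :=
  boundary_of_locusCovers F.toLatticeSituation P ρ qK hpin.1.2 hJ h hhas

end Law

/-! ## 4. Cells by name: P♮∪ at the boundary, CM below it, P♮ₑ and P♮ outside the confined regime -/

section Beds

open Cor312Vol.PinnedWitness Cor312Vol.UnionWitness Cor312Vol.ExcursionWitness Cor312Vol.NaturalWitness Cor312Vol.SplitWitness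

variable (p : ℕ) [Fact p.Prime]

/-- **P♮∪ is q-confined** at every packet: there the q-pilot region IS the union of the possible images
(`UnionWitness.qRegion_eq_sUnion_possibleImages`, p451547). [folklore] -/
theorem union_confined (j : Checks.toyIndex.Label) (vQ : Checks.toyIndex.VQ) :
    ∀ U ∈ (uSetting p).possibleImages j vQ, U ⊆ (uSetting p).qRegion j vQ := fun U hU => by
  rw [qRegion_eq_sUnion_possibleImages p j vQ]
  exact Set.subset_sUnion_of_mem hU

/-- **P♮∪'s equality RE-DERIVED THROUGH THE LAW** (§3, no volume table read): q-pin `uSetting_qPinned` + H_J3 `CandJoshi3Union.union_locusCovers`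
+ confinement + trivial `HasHull` ⟹ Statement ∧ `−|log(Θ)| = −|log(q)|`; concordant with the bed's own `uSetting_statement` and with abc-iut-rp-s1's
`ObstructionSS45.union_boundary_via_law` (ratio profile `1/j²`). [folklore] -/
theorem union_boundary_by_law :
    (uSetting p).Statement ∧ (uSetting p).negLogTheta = (((uSetting p).negLogQ : ℝ) : WithTop ℝ) :=
  boundary_of_locusCovers (uFull p).toLatticeSituation (uSetting p) (ptRegion p) (qDatumU p) (uSetting_qPinned p)
    (CandJoshi3Union.union_locusCovers p) (fun _ vQ => union_confined p _ vQ) fun _ _ => trivial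

/-- **The pinned countermodel is q-confined and sits BELOW the boundary**: abc-iut-rp-d2's `CandInternal8.nested_pinnedSetting` (every possible
image `±B_{j²} ⊆ B_1`) and abc-iut-w4-d101's `pinnedSetting_not_statement` — the hull is the Θ-ball itself (abc-iut-rp-h3's
`CandDupuyHilado32.orbitInside_pinnedSetting`), the q-region is never filled. [folklore] -/
theorem pinned_confined_not_statement :
    (∀ (j : Checks.toyIndex.Label) (vQ : Checks.toyIndex.VQ), ∀ U ∈ (pinnedSetting p).possibleImages j vQ, U ⊆ (pinnedSetting p).qRegion j vQ) ∧
      ¬ (pinnedSetting p).Statement :=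
  ⟨CandInternal8.nested_pinnedSetting p, pinnedSetting_not_statement p⟩

/-- **P♮ₑ (abc-iut-w5-d133's orbit-excursion bed) is NOT q-confined**: its typed Statement is STRICT (`−1/2 < −3/8`,
`ExcursionWitness.excSetting_statement_strict`), so by `exists_escape_of_strict` some permuted deep box leaves the q-POLYDISC at a packet of
`𝔽_l^⋇` (sharper than `excSetting_excursion`, which exits the Θ-box). Derived from the strict inequality alone. [folklore] -/
theorem exc_not_confined :
    ∃ (i : Fin splitIndex.lstar) (vQ : splitIndex.VQ), ∃ U ∈ excSetting.possibleImages (Setting.labelSucc i) vQ,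
      ¬ U ⊆ excSetting.qRegion (Setting.labelSucc i) vQ :=
  exists_escape_of_strict excFull.toLatticeSituation excSetting excSetting_bridgeHyps.mono excSetting_statement_strict.1
    excSetting_statement_strict.2

/-- **P♮ (abc-iut-w5-d230's natural (Ind2)-bed) is NOT q-confined**: its typed Statement is STRICT (`−2 < −1`,
`NaturalWitness.natSetting_statement_strict`), so some half-coset translate leaves the q-region at a packet of `𝔽_l^⋇`. [folklore] -/
theorem nat_not_confined :
    ∃ (i : Fin Checks.toyIndex.lstar) (vQ : Checks.toyIndex.VQ), ∃ U ∈ natSetting.possibleImages (Setting.labelSucc i) vQ,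
      ¬ U ⊆ natSetting.qRegion (Setting.labelSucc i) vQ :=
  exists_escape_of_strict natFull.toLatticeSituation natSetting natSetting_bridgeHyps.mono natSetting_statement_strict.1
    natSetting_statement_strict.2

end Beds

end Summit.ABC.IUTFork.Repair.CandJoshi3Boundary

end
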